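import Literature.Barriers.CriticalPhenomena.LongRangeTrivialityOnZ3MomentsGHS
import Literature.Barriers.CriticalPhenomena.LongRangeTrivialityOnZ3InputsProofs

/-!
# Panis's Theorem 1.2 (`panis_thm12`, every `d ≥ 1`) from printed statements: Aizenman's deviation
# display, the tree diagram bound and the three printed infrared bounds

Sibling of `Literature/Barriers/CriticalPhenomena/LongRangeTrivialityOnZ3.lean` (barrier catalogue
D-0021, sub-problem `Ising3DConformalLimit`), joining the two reductions of the named fact
`panis_thm12` (Panis 2023, arXiv:2309.05797, Theorem 1.2) now in the tree:

* `…MomentsGHS`: `panis_thm12_of_ghs : panis_evenMoment_deviation_le → panis_ursellFourBoxSum_le →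
  panis_thm12` — the moment-generating-function display of the proof of Theorem 5.5 (p. 21) from
  Aizenman's deviation display alone, the Gaussian domination coming from the GHS inequality
  (`…GaussianMGF`) instead of Newman's inequality;
* `…InputsProofs` (unit `provefact panis_ursellFourBoxSum_le`): `panis_ursellFourBoxSum_le_of_facts :
  panis_treeDiagramBound → panis_infraredBound_algebraic → panis_infraredBound_rp →
  panis_infraredBound_algebraic_lowDim → panis_ursellFourBoxSum_le` — page 22 in every `d ≥ 1` along
  the Messager–Miracle-Solé route (no Theorem 3.18).

Hence **`panis_thm12_of_printedFacts`**: Theorem 1.2 in every dimension from five printed statements —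
the first display of the proof of Theorem 5.5 (`panis_evenMoment_deviation_le`, "from Proposition 4.6",
random currents), the tree diagram bound (§4.2, Aizenman 1982), and the infrared bounds Proposition 3.8
(`panis_infraredBound_rp`), p. 16 last display (`panis_infraredBound_algebraic`) and p. 16 first display
with Remark 3.9 (`panis_infraredBound_algebraic_lowDim`) — all reflection-positivity / random-current
statements; the Messager–Miracle-Solé monotonicity, `χ_L ≤ CL^{-d}Σ_L`, the variance footnote, the
Gaussian domination and the summation being theorems of the tree. The same for the barrier,
`LongRangeTrivialityOnZ3.of_printedFacts` (compare `LongRangeTrivialityOnZ3.of_ghs`: four facts, with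
Theorem 3.18 in place of the two extra infrared statements).

## References

* R. Panis, arXiv:2309.05797 (2023) = Ann. Probab. 54 (2026): Theorem 1.2; proof of Theorem 5.5
  (pp. 21–22); §4.2 (tree diagram bound); Proposition 3.8, p. 16 and Remark 3.9 [Panis2023Triviality]
  (held; read pp. 5–7, 13–16, 19–22).
-/

noncomputable section

namespace Literature.Barriers.CriticalPhenomena

-- names the `@[deprecated]` (refuted) fact `panis_evenMoment_deviation_le` of `…Moments` on purpose: a vacuous record
-- of the printed chain (verdict clean-up 2026-08-16, `…Moments` §Verdict clean-up); REMOVE-WHEN this theorem is retired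
set_option linter.deprecated false in
/-- **Theorem 1.2 of Panis 2023 (every `d ≥ 1`) from five printed statements**: the deviation display
(random currents, Proposition 4.6), the tree diagram bound, and the three printed infrared bounds.
**Vacuous since 2026-08-16:** the hypothesis `panis_evenMoment_deviation_le` is refuted
(`not_panis_evenMoment_deviation_le_of_criticalBeta_pos`, `…Wick`, with
`panis_criticalBeta_pos_holds`; `…Moments`, §Verdict clean-up) — the conclusion is meanwhile a
theorem outright (`panis_mgfDeviation_le_ursellFourBoxSum_holds`, `panis_thm12_holds`,
`LongRangeTrivialityOnZ3_holds`).
[cite: Panis2023Triviality, Theorem 1.2 and proof of Theorem 5.5 (pp. 21–22)] -/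
theorem panis_thm12_of_printedFacts (h46 : panis_evenMoment_deviation_le) (hT : panis_treeDiagramBound)
    (hI : panis_infraredBound_algebraic) (hIrp : panis_infraredBound_rp)
    (hI2 : panis_infraredBound_algebraic_lowDim) : panis_thm12 :=
  panis_thm12_of_ghs h46 (panis_ursellFourBoxSum_le_of_facts hT hI hIrp hI2)

-- names the `@[deprecated]` (refuted) fact `panis_evenMoment_deviation_le` of `…Moments` on purpose: a vacuous record
-- of the printed chain (verdict clean-up 2026-08-16, `…Moments` §Verdict clean-up); REMOVE-WHEN this theorem is retired
set_option linter.deprecated false in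
/-- **The barrier `LongRangeTrivialityOnZ3` from the same five printed statements** (through
`LongRangeTrivialityOnZ3.of_thm12`: the `β_c = 0` case by independence, the variance footnote proved).
**Vacuous since 2026-08-16:** the hypothesis `panis_evenMoment_deviation_le` is refuted
(`not_panis_evenMoment_deviation_le_of_criticalBeta_pos`, `…Wick`, with
`panis_criticalBeta_pos_holds`; `…Moments`, §Verdict clean-up) — the conclusion is meanwhile a
theorem outright (`panis_mgfDeviation_le_ursellFourBoxSum_holds`, `panis_thm12_holds`,
`LongRangeTrivialityOnZ3_holds`).
[cite: Panis2023Triviality, Theorem 1.2] -/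
theorem LongRangeTrivialityOnZ3.of_printedFacts (h46 : panis_evenMoment_deviation_le)
    (hT : panis_treeDiagramBound) (hI : panis_infraredBound_algebraic) (hIrp : panis_infraredBound_rp)
    (hI2 : panis_infraredBound_algebraic_lowDim) : LongRangeTrivialityOnZ3 :=
  LongRangeTrivialityOnZ3.of_thm12 (panis_thm12_of_printedFacts h46 hT hI hIrp hI2)

end Literature.Barriers.CriticalPhenomena

end
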